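import Literature.Computability.Complexity.HarveyFactoringMachine
import HarnessLib

/-!
# `harvey_factoring_one_fifth` holds

Discharge of the named fact `harvey_factoring_one_fifth` of `PQCWave0.lean` (D. Harvey,
Math. Comp. 90 (2021), Thm. 1.1: a deterministic Turing machine factoring `N` in
`N^{1/5+o(1)}` time, i.e. `C_ε · 2^{(1/5+ε)n}` steps on `n`-bit inputs for every `ε > 0`), by the
machine built and analysed in `Literature/Computability/Complexity/StackHarvey*.lean` and
`HarveyFactoringMachine.lean` (trial division to `2^{⌈n/5⌉+1}`; for every composite cofactor
Harvey's Algorithm 3 — the small-factor searches by Bluestein/product-tree evaluation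
(Algorithm 1), the square test, the order search, and Algorithm 2's recovery of `N = pq` from
an element of large order —, with a counting argument for the supply of bases in place of the
printed appeal to explicit bounds on `π(x)`), which runs in `O(2^{n/5} n^{12})` steps of Mathlib's
`TM2` model (`Com.exists_factoring_machine`), and the bridge
`Harvey2021Bridge.harvey_factoring_one_fifth_of_time_bound_poly` absorbing the polynomial factor
into the `o(1)` of the exponent.

## References

* D. Harvey, *An exponent one-fifth algorithm for deterministic integer factorisation*,
  Math. Comp. 90 (2021) 2937–2950, Thm. 1.1 (arXiv:2010.05450 v3, Thm. 1). [Harvey2021]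
-/

namespace Literature.Computability.Cryptography

/-- **Harvey's theorem** (Math. Comp. 90 (2021), Thm. 1.1): deterministic integer factorisation
in `N^{1/5+o(1)}` time on a multitape (here: multi-stack `TM2`) Turing machine — the named fact
`harvey_factoring_one_fifth` holds. [cite: Harvey2021, Thm. 1.1 (arXiv:2010.05450 v3, Thm. 1)] -/
theorem harvey_factoring_one_fifth_holds : harvey_factoring_one_fifth := by
  obtain ⟨M, C, hC⟩ := Literature.Computability.Complexity.Com.exists_factoring_machine
  exact Harvey2021.harvey_factoring_one_fifth_of_time_bound_poly M C 12 hC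

end Literature.Computability.Cryptography
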